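import Summits.QuantumFields.BalabanUV.T4Continuum.Support.VariationalColourTowerEndLocal
import Summits.QuantumFields.BalabanUV.T4Continuum.Support.VariationalColourNestedTaxiFrames

/-!
# T⁴ programme, spine node NE2 (U1a), lane P2 — SUPPLIER ITEM «V-COL-TAXI-0FORM-END», file 2 of 2: THE COLOUR 0-FORM TOWER END AT THE OPERATOR TAXI TOWER —
# the frame-free END `towerLimitRate_colourTower_closed_local` INHABITED by a COHERENT tower of UNITARY one-step bond operators with NO frame and NO
# transport datum besides the bond operators: nested operator taxi frames `nestTv` as the carriers, the STRAIGHT level-`k` taxi as the reference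
# (the non-abelian ∕ `E`-valued 0-form twin of leaf-04-g3's U(1) `VariationalTaxiTowerEndLocal.towerLimitRate_taxiTower`, p216254; model level)

NE2 formalisation swarm `b2b-balaban-t4-ne2-formalise-*`, leaf prover 02 (gen 6); register P2-sup, item «V-COL-TAXI-0FORM-END» (INTENT CLAIMS.log l.17170).
Composition BY NAME of this lineage's frame-free END `VariationalColourTowerEndLocal.towerLimitRate_colourTower_closed_local` with file 1
`VariationalColourNestedTaxiFrames` (`hrel_nestTv`, `class_bounds`, `hw₀_taxi`, `hw₁_taxi`, `hin_taxi`) and leaf-04-g4's operator taxi dictionary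
(`taxiTv_mem_unitary`, `coarseTv_mem_unitary`, `nestTv_mem_unitary`, `coarseTv_plaq_le`, `norm_misv_taxi_le`, `hcross_taxiTv_le`, `coarseTv_eq_Rlev`; p219320 ∕
p219787 ∕ p222225).
 * **`towerLimitRate_colourTaxiTower`** — THE END AT TAXI DATA: for a COHERENT tower (`coarseTv (R′ (k+1)) = Rtrv (R′ k)`) of UNITARY one-step bond operators `R′ k`
   on a finite-dimensional Hilbert space `E`, one-step plaquette defects in the class `(L^k·L)²·b_k ≤ c`, `64d((d−1)c)² ≤ ½`, `2d((d−1)c)² + 4(((d−1)+d²)c)² ≤ ½`,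
   `1 ≤ d`, `2 ≤ L`, `1 < M_μ`, an orthonormal basis `ob` of `E`, `0 < a₀`:
   `TowerLimitRate (fun _ ↦ 1) 1 (k ↦ effC (L^k) M (coarseTv L (fine (L^k) M) (R′ k)) (nestTv L M R′ k) ob a₀) C⋆ L⁻¹` with the END's constant at
   `c_w′ = (4 + (d−1)c)∕(1 − ((d−1)+d²)c)`, `c_p = c`, `c_m = (d−1)c`, `c₁ = 2(d−1)c` — every level binder of the END discharged from the bond operators: `T₀ k :=` the
   straight level-`k` taxi, `γ := ((d−1)+d²)c` (`< 1` from the second smallness line), `w₀`, `w₁`, `m`, `m₁`, plaquette `L²b_k`, the three per-level smallness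
   lines and the four class lines; NO frame binder, NO transport datum, NO leaf displayed;
 * `towerLimitRate_colourTaxiTower_Rlev` — the same with the level bonds written `Rlev L M R′ k` (leaf-04-g4's letter for the vector END; `coarseTv_eq_Rlev`).
WHAT IS NOT HERE (stated, not hidden): any identification of `R′ k` with Bałaban's `U(Γ)` ∕ of `c` with his field-strength condition (c5, no B0); 1-forms (the
vector END at taxi data is leaf-04-g5's «V-COL-TAXI-END»); node NE3; an explicit non-abelian non-flat inhabitant of the class (the U(1) constant-flux tower
`VariationalTaxiTowerEndLocal.towerLimitRate_fluxTower` is the abelian one).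

HONEST FRAMING (T4-DAG p. 1).  Instantiation at MODEL level (unitary bond operators DATA; taxi ∕ straight contours OURS; [Balaban1985BackgroundPropagators]
(3.10) ∕ (3.15) ∕ (3.19) SHAPES only, no B0, c5); honest limit «small field PER UNIT BLOCK, k-uniform under the plaquette class» (the smallness is on the class
constant `c`, none on a gauge); [folklore] bookkeeping + real arithmetic; nothing printed is a hypothesis; no `def`, no `def … : Prop`, no `sorry`; axioms
standard.  NE2 NOT proved on either road; NE3 OPEN; spine PROVED 0∕9 unchanged; rung (B)+1 finite T⁴ — NOT infinite volume, NOT mass gap, NOT Clay.  HONEST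
DEPENDENCY (cell, verbatim): continuum YM on T⁴ ⇐ BetaPertH ∧ nine spine estimates (0/9 proved); BetaPertH ⇐ (D1) ∧ (D4) ∧ CAP+tail; G-an2-4 gates asym, D1
and NE2/3/4.
-/

noncomputable section

namespace Summit.QuantumFields.BalabanUV.T4Continuum.VariationalColourNestedTaxiEnd

open Finset
open scoped Matrix
open Literature.MathematicalPhysics.QuantumFieldTheory.Balaban1983to89
open Literature.MathematicalPhysics.QuantumFieldTheory.Balaban1983to89.B5Prop11Plancherel (Tor fine unitVec)
open Literature.MathematicalPhysics.QuantumFieldTheory.Balaban1983to89.B5Block118 (bpt)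
open Literature.MathematicalPhysics.QuantumFieldTheory.Balaban1983to89.B5Blocks16 (blockOf)
open Summit.QuantumFields.BalabanUV.T4Continuum.CovariantAveragingTower (TowerLimitRate)
open Summit.QuantumFields.BalabanUV.T4Continuum.VariationalColourFederbush (misv norm_le_one_of_mem_unitary)
open Summit.QuantumFields.BalabanUV.T4Continuum.VariationalColourTower (compTv Rtrv)
open Summit.QuantumFields.BalabanUV.T4Continuum.VariationalColourTaxiTransport
open Summit.QuantumFields.BalabanUV.T4Continuum.VariationalEffectiveHilbertPairs (effC)
open Summit.QuantumFields.BalabanUV.T4Continuum.VariationalVectorEndOfLeaves (eV ePV)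
open Summit.QuantumFields.BalabanUV.T4Continuum.VariationalColourTowerEndLocal (towerLimitRate_colourTower_closed_local)
open Summit.QuantumFields.BalabanUV.T4Continuum.VariationalColourNestedTaxiFrames (hrel_nestTv class_bounds lt_one_of_four_sq_le hw₀_taxi hw₁_taxi hin_taxi)

variable {d : ℕ}

/-! ## §3 The colour 0-form tower END at the operator taxi tower -/

section End

variable {E : Type*} [NormedAddCommGroup E] [InnerProductSpace ℂ E] [CompleteSpace E] [FiniteDimensional ℂ E]
variable (L : ℕ) [NeZero L] (M : Fin d → ℕ) [hM : ∀ μ, NeZero (M μ)] {κ : Type*} [Fintype κ] [DecidableEq κ]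

/-- **THE COLOUR 0-FORM TOWER END AT THE OPERATOR TAXI TOWER — NO FRAME, NO TRANSPORT DATUM BESIDES THE BOND OPERATORS.**  For a COHERENT tower of UNITARY one-step
bond operators `R′ k` on a finite-dimensional Hilbert space `E` with one-step plaquette defects `b_k` in the class `(L^k·L)²·b_k ≤ c`, the two polynomial smallness
lines `64d((d−1)c)² ≤ ½`, `2d((d−1)c)² + 4(((d−1)+d²)c)² ≤ ½`, and `1 ≤ d`, `2 ≤ L`, `1 < M_μ`, `0 < a₀`: the colour effective operators of the block averages with the
NESTED taxi frames, `effC (L^k) M (coarseTv L (fine (L^k) M) (R′ k)) (nestTv L M R′ k) ob a₀`, CONVERGE at rate `L⁻¹` on `Tor M × κ` — the frame-free END with every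
level binder discharged: `T₀ k :=` the straight level-`k` taxi, `γ := ((d−1)+d²)c`, `c_w′ = (4 + (d−1)c)∕(1−γ)`, `c_p = c`, `c_m = (d−1)c`, `c₁ = 2(d−1)c`.
Model level (small field PER UNIT BLOCK through `c`); NE2 NOT proved. [folklore] -/
theorem towerLimitRate_colourTaxiTower (hd : 1 ≤ d) (hL : 2 ≤ L) (hM2 : ∀ μ, 1 < M μ)
    {R' : (k : ℕ) → Tor (fine L (fine (L ^ k) M)) → Fin d → (E →L[ℂ] E)} (hU : ∀ k x μ, R' k x μ ∈ unitary (E →L[ℂ] E))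
    {b : ℕ → ℝ} (hb0 : ∀ k, 0 ≤ b k)
    (hb : ∀ k x κ ι, ‖R' k x κ * R' k (x + unitVec (fine L (fine (L ^ k) M)) κ) ι - R' k x ι * R' k (x + unitVec (fine L (fine (L ^ k) M)) ι) κ‖ ≤ b k)
    (hcoh : ∀ k, coarseTv L (fine (L ^ (k + 1)) M) (R' (k + 1)) = Rtrv (L ^ k) L M (R' k))
    {c : ℝ} (hclass : ∀ k, ((((L ^ k : ℕ)) : ℝ) * L) ^ 2 * b k ≤ c)
    (hc₁ : 64 * (d : ℝ) * (((d - 1 : ℕ) : ℝ) * c) ^ 2 ≤ 1 / 2)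
    (hc₂ : 2 * (d : ℝ) * (((d - 1 : ℕ) : ℝ) * c) ^ 2 + 4 * (((((d - 1 : ℕ) : ℝ) + (d : ℝ) * d) * c)) ^ 2 ≤ 1 / 2)
    (ob : OrthonormalBasis κ ℂ E) {a₀ : ℝ} (ha₀ : 0 < a₀) :
    let cw : ℝ := (4 + ((d - 1 : ℕ) : ℝ) * c) / (1 - (((d - 1 : ℕ) : ℝ) + (d : ℝ) * d) * c)
    let cm : ℝ := ((d - 1 : ℕ) : ℝ) * c
    let c₁ : ℝ := 2 * ((d - 1 : ℕ) : ℝ) * c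
    let Λcs : ℝ := 2 * d * (36 : ℝ) ^ d * ((1 + cw) ^ 2 + 9)
    let CRs : ℝ := 2 * Λcs + 2 * d * c + (d : ℝ) ^ 2 * c ^ 2 * 136
    let cε : ℝ := ((d : ℝ) / 4 + 1 / 2) * L
    let cδ' : ℝ := Real.sqrt (2 * d * (1 + (d : ℝ) ^ 2)) * ((L : ℝ) * c₁)
    let Λs : ℝ := Λcs + (cε * CRs + 2 * cδ' * Real.sqrt ((1 + cε * CRs) * 136) + cδ' ^ 2 * 136) * (Λcs + 1)
    TowerLimitRate (ι := fun _ => Tor M × κ) (fun _ => (1 : Matrix (Tor M × κ) (Tor M × κ) ℂ)) 1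
      (fun k => effC (L ^ k) M (coarseTv L (fine (L ^ k) M) (R' k)) (nestTv L M R' k) ob a₀)
      (eV Λs 136 (Real.sqrt d * cm) + ePV Λs 136 CRs cε cδ') ((L : ℝ)⁻¹) := by
  intro cw cm c₁ Λcs CRs cε cδ' Λs
  have hL1 : 1 ≤ L := by omega
  have hL1r : (1 : ℝ) ≤ L := by exact_mod_cast hL1
  have hd0 : 0 < d := hd
  have hdr : 0 ≤ ((d - 1 : ℕ) : ℝ) := Nat.cast_nonneg _
  have hR' : ∀ k x μ, ‖R' k x μ‖ ≤ 1 := fun k x μ => norm_le_one_of_mem_unitary (hU k x μ)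
  have hc0 : 0 ≤ c := le_trans (by have := hb0 0; positivity) (hclass 0)
  -- the relative operator `γ := ((d−1)+d²)c` is `< 1` (from `4γ² ≤ ½`)
  set γ : ℝ := (((d - 1 : ℕ) : ℝ) + (d : ℝ) * d) * c with hγdef
  have hγsq : 4 * γ ^ 2 ≤ 1 / 2 := by
    have h0 : 0 ≤ 2 * (d : ℝ) * (((d - 1 : ℕ) : ℝ) * c) ^ 2 := by positivity
    linarith
  have hγ1 : γ < 1 := lt_one_of_four_sq_le hγsq
  have hγ' : 0 < 1 - γ := by linarith
  -- the class lines per level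
  have hn1 : ∀ k, 1 ≤ L ^ k := fun k => Nat.one_le_iff_ne_zero.mpr (NeZero.ne (L ^ k))
  have hcls := fun k => class_bounds (d := d) (hn1 k) hL1 (hb0 k) (hclass k)
  -- the fictitious defect `w′ k := cw / L^k`
  have hnk : ∀ k, (0 : ℝ) < (((L ^ k : ℕ)) : ℝ) := fun k => by exact_mod_cast Nat.pos_of_ne_zero (NeZero.ne (L ^ k))
  have hcw : cw = (4 + ((d - 1 : ℕ) : ℝ) * c) / (1 - γ) := rfl
  have hcw0 : 0 ≤ cw := by rw [hcw]; exact div_nonneg (by positivity) hγ'.le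
  have hcancel : ∀ k, (((L ^ k : ℕ)) : ℝ) * (cw / (((L ^ k : ℕ)) : ℝ)) = cw := fun k => mul_div_cancel₀ _ (hnk k).ne'
  refine towerLimitRate_colourTower_closed_local L M
    (Rc := fun k => coarseTv L (fine (L ^ k) M) (R' k)) (T := nestTv L M R')
    (T₀ := fun k => taxiTv (L ^ k) M (coarseTv L (fine (L ^ k) M) (R' k)))
    (R' := R') (T' := fun k => taxiTv L (fine (L ^ k) M) (R' k)) hL
    (fun k => rfl) (fun k => hcoh k)
    (nestTv_mem_unitary L M hU) (fun k => coarseTv_mem_unitary L (fine (L ^ k) M) (hU k))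
    (fun k => (L : ℝ) * L * b k) (fun k => by have := hb0 k; positivity)
    (fun k x μ ν => coarseTv_plaq_le L (fine (L ^ k) M) (hR' k) (hb k) x μ ν)
    (fun k x => taxiTv_mem_unitary (L ^ k) M (coarseTv_mem_unitary L (fine (L ^ k) M) (hU k)) x)
    (fun k => ((d - 1 : ℕ) : ℝ) * ((L ^ k - 1 : ℕ) : ℝ) * ((L : ℝ) * L * b k)) (fun k => by have := hb0 k; positivity)
    (fun k x μ hx => hw₀_taxi (L ^ k) L M (hU k) (hb k) hM2 x μ hx)
    hγ1 (fun k x => hrel_nestTv L M hd0 hL1r hU hb0 hb hcoh hclass k x)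
    (fun k => ?_)
    (fun k => cw / (((L ^ k : ℕ)) : ℝ)) (fun k => div_nonneg hcw0 (hnk k).le) (fun k => ?_)
    (fun k x => taxiTv_mem_unitary L (fine (L ^ k) M) (hU k) x) hR'
    (fun k => ((d - 1 : ℕ) : ℝ) * ((L - 1 : ℕ) : ℝ) * b k) (fun k x μ hx => hw₁_taxi (L ^ k) L M (hU k) (hb k) hM2 x μ hx) (fun k => ?_)
    (fun k => ((d - 1 : ℕ) : ℝ) * L * ((L - 1 : ℕ) : ℝ) * b k) (fun k => by have := hb0 k; positivity)
    (fun k y μ j => norm_misv_taxi_le L (fine (L ^ k) M) (hR' k) (hb k) y μ j) (fun k => ?_)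
    (fun k => ((d - 1 : ℕ) : ℝ) * ((L - 1 : ℕ) : ℝ) * ((2 * L - 1 : ℕ) : ℝ) * b k) (fun k => by have := hb0 k; positivity)
    (fun k y j μ h => hin_taxi (L ^ k) L M (hU k) (hb k) (hb0 k) y j μ h)
    (fun k y j μ h => hcross_taxiTv_le L (fine (L ^ k) M) (hU k) (hb k) y j μ h)
    (cw := cw) (cp := c) (cm := cm) (c₁ := c₁)
    (fun k => (hcancel k).le) (fun k => (hcls k).2.1) (fun k => (hcls k).2.2.1) (fun k => (hcls k).2.2.2.2.1) ob ha₀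
  · -- per-block smallness `2d(n·w₀)² + 4γ² ≤ ½` from `n·w₀ ≤ (d−1)c`
    have h1 : (((L ^ k : ℕ)) : ℝ) * (((d - 1 : ℕ) : ℝ) * ((L ^ k - 1 : ℕ) : ℝ) * ((L : ℝ) * L * b k)) ≤ ((d - 1 : ℕ) : ℝ) * c := (hcls k).1
    have h0 : 0 ≤ (((L ^ k : ℕ)) : ℝ) * (((d - 1 : ℕ) : ℝ) * ((L ^ k - 1 : ℕ) : ℝ) * ((L : ℝ) * L * b k)) := by have := hb0 k; positivity
    have hsq := pow_le_pow_left₀ h0 h1 2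
    have hd2 : (0 : ℝ) ≤ 2 * d := by positivity
    nlinarith [mul_le_mul_of_nonneg_left hsq hd2]
  · -- the fictitious defect: `(4 + n·w₀)/(1−γ) − 1 ≤ n·w′ = cw`
    rw [hcancel k, hcw]
    have h1 : (((L ^ k : ℕ)) : ℝ) * (((d - 1 : ℕ) : ℝ) * ((L ^ k - 1 : ℕ) : ℝ) * ((L : ℝ) * L * b k)) ≤ ((d - 1 : ℕ) : ℝ) * c := (hcls k).1
    have hmono : (4 + (((L ^ k : ℕ)) : ℝ) * (((d - 1 : ℕ) : ℝ) * ((L ^ k - 1 : ℕ) : ℝ) * ((L : ℝ) * L * b k))) / (1 - γ)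
        ≤ (4 + ((d - 1 : ℕ) : ℝ) * c) / (1 - γ) := div_le_div_of_nonneg_right (by linarith) hγ'.le
    linarith
  · -- one-step smallness `2d(L·w₁)² ≤ ½` from `L·w₁ ≤ (d−1)c`
    have h1 : (L : ℝ) * (((d - 1 : ℕ) : ℝ) * ((L - 1 : ℕ) : ℝ) * b k) ≤ ((d - 1 : ℕ) : ℝ) * c := (hcls k).2.2.2.2.2
    have h0 : 0 ≤ (L : ℝ) * (((d - 1 : ℕ) : ℝ) * ((L - 1 : ℕ) : ℝ) * b k) := by have := hb0 k; positivity
    have hsq := pow_le_pow_left₀ h0 h1 2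
    have h4 : 0 ≤ 4 * γ ^ 2 := by positivity
    have hd2 : (0 : ℝ) ≤ 2 * d := by positivity
    nlinarith [mul_le_mul_of_nonneg_left hsq hd2]
  · -- FED⁺ absorption `64d(n·m)² ≤ ½` from `n·m ≤ (d−1)c`
    have h1 : (((L ^ k : ℕ)) : ℝ) * (((d - 1 : ℕ) : ℝ) * L * ((L - 1 : ℕ) : ℝ) * b k) ≤ ((d - 1 : ℕ) : ℝ) * c := (hcls k).2.2.2.1
    have h0 : 0 ≤ (((L ^ k : ℕ)) : ℝ) * (((d - 1 : ℕ) : ℝ) * L * ((L - 1 : ℕ) : ℝ) * b k) := by have := hb0 k; positivity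
    have hsq := pow_le_pow_left₀ h0 h1 2
    have hd2 : (0 : ℝ) ≤ 64 * d := by positivity
    nlinarith [mul_le_mul_of_nonneg_left hsq hd2]

/-- **THE SAME END WITH THE LEVEL BONDS WRITTEN `Rlev L M R′ k`** (leaf-04-g4's letter for the vector END; `coarseTv (R′ k) = Rlev k` by coherence). [folklore] -/
theorem towerLimitRate_colourTaxiTower_Rlev (hd : 1 ≤ d) (hL : 2 ≤ L) (hM2 : ∀ μ, 1 < M μ)
    {R' : (k : ℕ) → Tor (fine L (fine (L ^ k) M)) → Fin d → (E →L[ℂ] E)} (hU : ∀ k x μ, R' k x μ ∈ unitary (E →L[ℂ] E))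
    {b : ℕ → ℝ} (hb0 : ∀ k, 0 ≤ b k)
    (hb : ∀ k x κ ι, ‖R' k x κ * R' k (x + unitVec (fine L (fine (L ^ k) M)) κ) ι - R' k x ι * R' k (x + unitVec (fine L (fine (L ^ k) M)) ι) κ‖ ≤ b k)
    (hcoh : ∀ k, coarseTv L (fine (L ^ (k + 1)) M) (R' (k + 1)) = Rtrv (L ^ k) L M (R' k))
    {c : ℝ} (hclass : ∀ k, ((((L ^ k : ℕ)) : ℝ) * L) ^ 2 * b k ≤ c)
    (hc₁ : 64 * (d : ℝ) * (((d - 1 : ℕ) : ℝ) * c) ^ 2 ≤ 1 / 2)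
    (hc₂ : 2 * (d : ℝ) * (((d - 1 : ℕ) : ℝ) * c) ^ 2 + 4 * (((((d - 1 : ℕ) : ℝ) + (d : ℝ) * d) * c)) ^ 2 ≤ 1 / 2)
    (ob : OrthonormalBasis κ ℂ E) {a₀ : ℝ} (ha₀ : 0 < a₀) :
    let cw : ℝ := (4 + ((d - 1 : ℕ) : ℝ) * c) / (1 - (((d - 1 : ℕ) : ℝ) + (d : ℝ) * d) * c)
    let cm : ℝ := ((d - 1 : ℕ) : ℝ) * c
    let c₁ : ℝ := 2 * ((d - 1 : ℕ) : ℝ) * c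
    let Λcs : ℝ := 2 * d * (36 : ℝ) ^ d * ((1 + cw) ^ 2 + 9)
    let CRs : ℝ := 2 * Λcs + 2 * d * c + (d : ℝ) ^ 2 * c ^ 2 * 136
    let cε : ℝ := ((d : ℝ) / 4 + 1 / 2) * L
    let cδ' : ℝ := Real.sqrt (2 * d * (1 + (d : ℝ) ^ 2)) * ((L : ℝ) * c₁)
    let Λs : ℝ := Λcs + (cε * CRs + 2 * cδ' * Real.sqrt ((1 + cε * CRs) * 136) + cδ' ^ 2 * 136) * (Λcs + 1)
    TowerLimitRate (ι := fun _ => Tor M × κ) (fun _ => (1 : Matrix (Tor M × κ) (Tor M × κ) ℂ)) 1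
      (fun k => effC (L ^ k) M (Rlev L M R' k) (nestTv L M R' k) ob a₀)
      (eV Λs 136 (Real.sqrt d * cm) + ePV Λs 136 CRs cε cδ') ((L : ℝ)⁻¹) := by
  intro cw cm c₁ Λcs CRs cε cδ' Λs
  have e : (fun k => effC (L ^ k) M (Rlev L M R' k) (nestTv L M R' k) ob a₀)
      = (fun k => effC (L ^ k) M (coarseTv L (fine (L ^ k) M) (R' k)) (nestTv L M R' k) ob a₀) := by
    funext k; rw [coarseTv_eq_Rlev L M R' hcoh k]
  rw [e]
  exact towerLimitRate_colourTaxiTower L M hd hL hM2 hU hb0 hb hcoh hclass hc₁ hc₂ ob ha₀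

end End

end Summit.QuantumFields.BalabanUV.T4Continuum.VariationalColourNestedTaxiEnd

end
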